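import Mathlib
import HarnessLib.Audit
import Summits.PneNP.PneNP.Theorems.PstarGateNodesX
import Summits.PneNP.PneNP.Theorems.PstarGateCasePNorHolders

/-!
# One GATED chord: the global budget with a SET of cross gates (E2 node N4X; prover-1 g20)

FRONTIER range-avoidance ladder, rung F-N3 (`stmt-PneNP-19007`), cell `pnp-ideate` (`PstarGateNodesX`); restricted-model proof complexity —
nothing here bears on `P` versus `NP`.

The boundary count of `PstarGateBudget.gate_budget` / `PstarGateBudgetCross.gate_budget_cross` on `X = J₀ ∪ {g₀} ∪ O` for a finite set `O` of
further pendant gates outside `J₀ ∪ {g₀}`, each with BOTH AND variables read inside `J₀` ("cross gates"): every `o ∈ O` pays at most its two XOR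
slots, so `(r, 3/2)`-expansion reads

* `gate_budget_crosses` — **`#(J₀ ∖ N) + 1 ≤ #N + #O + 2·#Pv`**, `Pv` = the tree edges both of whose AND variables are private within
  `J₀ ∪ {g₀} ∪ O` (for `O = ∅` this is `gate_budget`, for `#O = 1` it is `gate_budget_cross`).
-/

set_option linter.dupNamespace false -- `Summit.PneNP.PneNP.…`: summit = sub-problem name (D-0017 single-conjunct layout)

open Finset Literature.Computability.Complexity
open Summit.PneNP.PneNP.Theorems.PstarSALevel (varSet bdry BoundaryExpanding SimpleOverlap)
open Summit.PneNP.PneNP.Theorems.PstarCentreFree (vars_mem_varSet)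
open Summit.PneNP.PneNP.Theorems.PstarXCore (xverts)
open Summit.PneNP.PneNP.Theorems.PstarCoreBound (XorClosed)
open Summit.PneNP.PneNP.Theorems.PstarChordSystem (ChordSystem)
open Summit.PneNP.PneNP.Theorems.PstarChordBridgeTools (privs coef)
open Summit.PneNP.PneNP.Theorems.PstarChordBridge (BridgeData sys Solution Lift)
open Summit.PneNP.PneNP.Theorems.PstarNorCoreTools (not_mem_bdry_of_two card_varSet_inter_bdry_le card_bdry_le_sum)
open Summit.PneNP.PneNP.Theorems.PstarGateBridge (GateHyp)
open Summit.PneNP.PneNP.Theorems.PstarGateCasePNorHolders (not_mem_bdry_of_closed card_three_slots)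
open Summit.PneNP.PneNP.Theorems.PstarGateNodes (GateData)
open Summit.PneNP.PneNP.Theorems.PstarGateNodesX (GateDataX)

namespace Summit.PneNP.PneNP.Theorems.PstarGateBudgetCrosses

variable {n m : ℕ}

/-- **The global budget with a set of cross gates.**  See the module docstring. -/
theorem gate_budget_crosses (I : LocalMap 4 n m) {r₀ : ℕ} (hB : BoundaryExpanding r₀ I) {B : BridgeData n m} {e g₀ : Fin m}
    {u : Fin n} {κ₀ : ZMod 2} (hD : GateDataX I r₀ B e g₀ u κ₀) {O : Finset (Fin m)} (hO : O ⊆ B.G₁ ∪ B.G₂)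
    (hOJ : Disjoint O B.J₀) (hOg : g₀ ∉ O)
    (hold : ∀ o ∈ O, (∃ j ∈ B.J₀, I.vars o 2 ∈ varSet I j) ∧ (∃ j ∈ B.J₀, I.vars o 3 ∈ varSet I j)) :
    ∃ Pv ⊆ B.J₀ \ B.N,
      (∀ j ∈ Pv, ∀ j' ∈ O ∪ insert g₀ B.J₀, j' ≠ j → I.vars j 2 ∉ varSet I j' ∧ I.vars j 3 ∉ varSet I j') ∧
      (B.J₀ \ B.N).card + 1 ≤ B.N.card + O.card + 2 * Pv.card := by
  classical
  obtain ⟨hXc, hW, hr, hd₁, -, -, -, -, hG, hg₀, hgv, hju, -⟩ := id hD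
  have he : e ∈ B.N := hG.1
  have heJ : e ∈ B.J₀ := hW.hN he
  have hg₀J : g₀ ∉ B.J₀ := fun h => disjoint_left.1 hd₁ hg₀ h
  set F := B.J₀ \ B.N with hFdef
  have hFJ : F ⊆ B.J₀ := sdiff_subset
  set X : Finset (Fin m) := O ∪ insert g₀ B.J₀ with hXdef
  set Pv := F.filter (fun j => ∀ j' ∈ X, j' ≠ j → I.vars j 2 ∉ varSet I j' ∧ I.vars j 3 ∉ varSet I j') with hPv
  refine ⟨Pv, filter_subset _ _, fun j hj => (mem_filter.1 hj).2, ?_⟩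
  have hJX : B.J₀ ⊆ X := (subset_insert _ _).trans subset_union_right
  have hg₀X : g₀ ∈ X := mem_union_right _ (mem_insert_self _ _)
  have hOX : O ⊆ X := subset_union_left
  have hOdisj : Disjoint O (insert g₀ B.J₀) := by
    rw [disjoint_insert_right]; exact ⟨hOg, hOJ⟩
  have hXr : X.card ≤ r₀ := by
    refine (card_le_card ?_).trans hr
    refine union_subset (fun o ho => ?_) (insert_subset (mem_union_left _ (mem_union_right _ hg₀)) (subset_union_left.trans subset_union_left))
    rcases mem_union.1 (hO ho) with h | h
    · exact mem_union_left _ (mem_union_right _ h)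
    · exact mem_union_right _ h
  have hXcard : X.card = O.card + (B.J₀.card + 1) := by
    rw [hXdef, card_union_of_disjoint hOdisj, card_insert_of_notMem hg₀J]
  obtain ⟨jᵤ, hjᵤF, hjᵤu⟩ := hju
  have hu_jᵤ : u ∈ varSet I jᵤ := by rcases hjᵤu with h | h <;> rw [h] <;> exact vars_mem_varSet I jᵤ _
  have hp_g₀ : I.vars e 2 ∈ varSet I g₀ := by
    rcases hgv with ⟨h2, -⟩ | ⟨-, h3⟩
    · exact h2 ▸ vars_mem_varSet I g₀ 2
    · exact h3 ▸ vars_mem_varSet I g₀ 3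
  have hOJ' : ∀ o ∈ O, o ∉ B.J₀ := fun o ho h => disjoint_left.1 hOJ ho h
  -- per-output budgets
  let q : Fin m → ℕ := fun k => if k ∈ O then 2 else if k = g₀ then 2 else if k ∈ B.N.erase e then 2 else if k ∈ Pv then 2 else 1
  have htwo : ∀ k ∈ X, k ∈ B.J₀ → (varSet I k ∩ bdry I X).card ≤ 2 := by
    intro k hk hkJ
    have h := card_varSet_inter_bdry_le I X k {0, 1} (fun s hs => by
      simp only [mem_insert, mem_singleton] at hs
      rcases hs with rfl | rfl
      · exact not_mem_bdry_of_closed I hXc hJX hkJ (by decide)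
      · exact not_mem_bdry_of_closed I hXc hJX hkJ (by decide))
    have h2 : ({0, 1} : Finset (Fin 4)).card = 2 := by decide
    rw [h2] at h; exact h
  have hq : ∀ k ∈ X, (varSet I k ∩ bdry I X).card ≤ q k := by
    intro k hk
    by_cases hko : k ∈ O
    · simp only [q, if_pos hko]
      obtain ⟨⟨j2, hj2, hv2⟩, ⟨j3, hj3, hv3⟩⟩ := hold k hko
      have h := card_varSet_inter_bdry_le I X k {2, 3} (fun s hs => by
        simp only [mem_insert, mem_singleton] at hs
        rcases hs with rfl | rfl
        · exact not_mem_bdry_of_two I hk (hJX hj2) (fun h => hOJ' k hko (h ▸ hj2)) (vars_mem_varSet I k 2) hv2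
        · exact not_mem_bdry_of_two I hk (hJX hj3) (fun h => hOJ' k hko (h ▸ hj3)) (vars_mem_varSet I k 3) hv3)
      have h2 : ({2, 3} : Finset (Fin 4)).card = 2 := by decide
      rw [h2] at h; exact h
    by_cases hkg₀ : k = g₀
    · subst hkg₀
      simp only [q, if_neg hko, if_true]
      have h := card_varSet_inter_bdry_le I X k {2, 3} (fun s hs => by
        simp only [mem_insert, mem_singleton] at hs
        rcases hs with rfl | rfl
        · rcases hgv with ⟨h2, -⟩ | ⟨h2, -⟩
          · exact not_mem_bdry_of_two I hk (hJX heJ) (fun h => hg₀J (h ▸ heJ)) (vars_mem_varSet I k 2) (h2 ▸ vars_mem_varSet I e 2)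
          · exact not_mem_bdry_of_two I hk (hJX (hFJ hjᵤF)) (fun h => hg₀J (h ▸ hFJ hjᵤF)) (vars_mem_varSet I k 2) (h2 ▸ hu_jᵤ)
        · rcases hgv with ⟨-, h3⟩ | ⟨-, h3⟩
          · exact not_mem_bdry_of_two I hk (hJX (hFJ hjᵤF)) (fun h => hg₀J (h ▸ hFJ hjᵤF)) (vars_mem_varSet I k 3) (h3 ▸ hu_jᵤ)
          · exact not_mem_bdry_of_two I hk (hJX heJ) (fun h => hg₀J (h ▸ heJ)) (vars_mem_varSet I k 3) (h3 ▸ vars_mem_varSet I e 2))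
      have h2 : ({2, 3} : Finset (Fin 4)).card = 2 := by decide
      rw [h2] at h; exact h
    have hkJ : k ∈ B.J₀ := by
      rw [hXdef, mem_union, mem_insert] at hk
      rcases hk with h | h | h
      · exact absurd h hko
      · exact absurd h hkg₀
      · exact h
    by_cases hkN : k ∈ B.N.erase e
    · simp only [q, if_neg hko, if_neg hkg₀, if_pos hkN]
      exact htwo k hk hkJ
    by_cases hkP : k ∈ Pv
    · simp only [q, if_neg hko, if_neg hkg₀, if_neg hkN, if_pos hkP]
      exact htwo k hk hkJ
    · simp only [q, if_neg hko, if_neg hkg₀, if_neg hkN, if_neg hkP]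
      -- `e`, or a non-private tree edge: one AND slot held elsewhere
      obtain ⟨s, hs2, k', hk', hne', hv⟩ : ∃ s : Fin 4, 2 ≤ s.val ∧ ∃ k' ∈ X, k' ≠ k ∧ I.vars k s ∈ varSet I k' := by
        by_cases hke : k = e
        · subst hke
          exact ⟨2, by decide, g₀, hg₀X, fun h => hg₀J (h ▸ heJ), hp_g₀⟩
        have hkF : k ∈ F := mem_sdiff.2 ⟨hkJ, fun hkN' => hkN (mem_erase.2 ⟨hke, hkN'⟩)⟩
        have hnp : ¬ ∀ j' ∈ X, j' ≠ k → I.vars k 2 ∉ varSet I j' ∧ I.vars k 3 ∉ varSet I j' :=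
          fun h => hkP (mem_filter.2 ⟨hkF, h⟩)
        push Not at hnp
        obtain ⟨j', hj'X, hj'k, hj'⟩ := hnp
        by_cases h2 : I.vars k 2 ∈ varSet I j'
        · exact ⟨2, by decide, j', hj'X, hj'k, h2⟩
        · exact ⟨3, by decide, j', hj'X, hj'k, hj' h2⟩
      have h := card_varSet_inter_bdry_le I X k {0, 1, s} (fun s' hs' => by
        simp only [mem_insert, mem_singleton] at hs'
        rcases hs' with rfl | rfl | rfl
        · exact not_mem_bdry_of_closed I hXc hJX hkJ (by decide)
        · exact not_mem_bdry_of_closed I hXc hJX hkJ (by decide)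
        · exact not_mem_bdry_of_two I hk hk' (Ne.symm hne') (vars_mem_varSet I k s') hv)
      rw [card_three_slots hs2] at h
      exact h
  have hbd := card_bdry_le_sum I X q hq
  -- evaluate the sum over `X = O ⊔ {g₀} ⊔ N ⊔ F`
  have hqg₀ : q g₀ = 2 := by
    show (if g₀ ∈ O then 2 else if g₀ = g₀ then 2 else if g₀ ∈ B.N.erase e then 2 else if g₀ ∈ Pv then 2 else 1) = 2
    rw [if_neg hOg, if_pos rfl]
  have hJsplit : B.J₀ = B.N ∪ F := by rw [hFdef, union_sdiff_of_subset hW.hN]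
  have hdisj : Disjoint B.N F := by rw [hFdef]; exact disjoint_sdiff
  have hsumO : ∑ k ∈ O, q k = 2 * O.card := by
    rw [mul_comm, card_eq_sum_ones, sum_mul]
    refine sum_congr rfl fun k hk => ?_
    show (if k ∈ O then 2 else if k = g₀ then 2 else if k ∈ B.N.erase e then 2 else if k ∈ Pv then 2 else 1) = 1 * 2
    rw [if_pos hk, one_mul]
  have hsumN : ∑ k ∈ B.N, q k = 1 + 2 * (B.N.erase e).card := by
    rw [← add_sum_erase B.N q he]
    have heg₀ : e ≠ g₀ := fun h => hg₀J (h ▸ heJ)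
    have heP : e ∉ Pv := fun h => (mem_sdiff.1 (mem_filter.1 h).1).2 he
    have heO : e ∉ O := fun h => hOJ' e h heJ
    have hqe : q e = 1 := by
      show (if e ∈ O then 2 else if e = g₀ then 2 else if e ∈ B.N.erase e then 2 else if e ∈ Pv then 2 else 1) = 1
      rw [if_neg heO, if_neg heg₀, if_neg (notMem_erase e B.N), if_neg heP]
    rw [hqe, mul_comm, card_eq_sum_ones, sum_mul]
    congr 1
    refine sum_congr rfl fun k hk => ?_
    have hkJ : k ∈ B.J₀ := hW.hN (mem_of_mem_erase hk)
    have hkg₀ : k ≠ g₀ := fun h => hg₀J (h ▸ hkJ)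
    have hko : k ∉ O := fun h => hOJ' k h hkJ
    show (if k ∈ O then 2 else if k = g₀ then 2 else if k ∈ B.N.erase e then 2 else if k ∈ Pv then 2 else 1) = 1 * 2
    rw [if_neg hko, if_neg hkg₀, if_pos hk, one_mul]
  have hsumF : ∑ k ∈ F, q k = F.card + Pv.card := by
    have hsplit := (sum_filter_add_sum_filter_not F (fun k => k ∈ Pv) q).symm
    have hf1 : F.filter (fun k => k ∈ Pv) = Pv := by
      ext k
      simp only [mem_filter]
      exact ⟨fun h => h.2, fun h => ⟨(mem_filter.1 h).1, h⟩⟩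
    rw [hsplit, hf1]
    have h1 : ∑ k ∈ Pv, q k = 2 * Pv.card := by
      rw [mul_comm, card_eq_sum_ones, sum_mul]
      refine sum_congr rfl fun k hk => ?_
      have hkF := (mem_filter.1 hk).1
      have hkg₀ : k ≠ g₀ := fun h => hg₀J (h ▸ hFJ hkF)
      have hkN : k ∉ B.N.erase e := fun h => (mem_sdiff.1 hkF).2 (mem_of_mem_erase h)
      have hko : k ∉ O := fun h => hOJ' k h (hFJ hkF)
      show (if k ∈ O then 2 else if k = g₀ then 2 else if k ∈ B.N.erase e then 2 else if k ∈ Pv then 2 else 1) = 1 * 2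
      rw [if_neg hko, if_neg hkg₀, if_neg hkN, if_pos hk, one_mul]
    have h2 : ∑ k ∈ F.filter (fun k => k ∉ Pv), q k = (F.filter (fun k => k ∉ Pv)).card := by
      rw [card_eq_sum_ones]
      refine sum_congr rfl fun k hk => ?_
      obtain ⟨hkF, hkP⟩ := mem_filter.1 hk
      have hkg₀ : k ≠ g₀ := fun h => hg₀J (h ▸ hFJ hkF)
      have hkN : k ∉ B.N.erase e := fun h => (mem_sdiff.1 hkF).2 (mem_of_mem_erase h)
      have hko : k ∉ O := fun h => hOJ' k h (hFJ hkF)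
      show (if k ∈ O then 2 else if k = g₀ then 2 else if k ∈ B.N.erase e then 2 else if k ∈ Pv then 2 else 1) = 1
      rw [if_neg hko, if_neg hkg₀, if_neg hkN, if_neg hkP]
    rw [h1, h2]
    have hc := card_filter_add_card_filter_not (s := F) (fun k => k ∈ Pv)
    rw [hf1] at hc
    omega
  have hsumX : ∑ k ∈ X, q k = 2 * O.card + (2 + ((1 + 2 * (B.N.erase e).card) + (F.card + Pv.card))) := by
    rw [hXdef, sum_union hOdisj, sum_insert hg₀J, hsumO, hqg₀, hJsplit, sum_union hdisj, hsumN, hsumF]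
  have hexp := hB X hXr
  rw [hXcard] at hexp
  rw [hsumX, card_erase_of_mem he] at hbd
  have hJcard : B.J₀.card = B.N.card + F.card := by rw [hJsplit, card_union_of_disjoint hdisj]
  have hNpos : 1 ≤ B.N.card := card_pos.2 ⟨e, he⟩
  omega

end Summit.PneNP.PneNP.Theorems.PstarGateBudgetCrosses
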